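import Literature.NumberTheory.IwasawaTheory.Greenberg2016.GlobalToLocalSurjectivityCaseCInputs
import Literature.NumberTheory.IwasawaTheory.Greenberg2016.DualSelmerCokernelTorsion
import Literature.NumberTheory.IwasawaTheory.Greenberg2016.RestrictedRamificationLevelLift
import Literature.NumberTheory.GaloisRepresentations.TateDualLimitDualConditionLevels
import HarnessLib

/-!
# Greenberg 2010 Prop. 3.2.1, step (β) GLUED: `S_{𝓛*}(K, T*)` is `Λ`-torsion modulo `Ш¹(K, Σ, T*)`
# for the layers `𝐃[𝔪ᵏ]` (theorems only)

Topic `NumberTheory/IwasawaTheory/Greenberg2016`; namespace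
`Literature.NumberTheory.IwasawaTheory.Greenberg2016`. THEOREMS ONLY (no definition, no named fact, no
`sorry`, no instance). Seat `bsd-line-x1-p1-w4` gen 18 (prover, width seat of cell `bsd-eis`), brick (a)
«hC5 glue» of the road memo «SUR-Λ» (crux `GoodLatticeBDPValue`, stmt-BirchSwinnertonDyer-19032; target
`prop263_sur_of_crk_caseC_tc`), feeding the hypothesis `hC5` of the tree's
`Specification.sur_of_dualSelmer_inputs` (`GlobalToLocalSurjectivityCaseCInputs.lean`).

PRINT (R. Greenberg, Kyoto J. Math. 50 (2010), proof of Prop. 3.2.1, p. 15 L27–29): "By proposition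
3.1.1, and the assumption about the cokernel of `φ_𝓛`, it follows that `S_{𝓛*}(K, T*)` is a torsion
`Λ`-module" — precisely: Prop. 3.1.1 (p. 14) embeds `S_{𝓛*}(K, T*)/Ш¹(K, Σ, T*)` into
`Hom(coker(φ_𝓛), ℚ_p/ℤ_p)` `Λ`-equivariantly, and the latter is `Λ`-torsion when `coker(φ_𝓛)` is
cotorsion; §3.1 (p. 14 L13–26): the embedding is `y ↦ (t̄ ↦ ∑_{v ∈ Σ} ⟪t_v, y_v⟫_v)`, well defined on
`coker(φ_𝓛)` by Poitou–Tate ("`G` and `G*` are orthogonal complements under (9)").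

WHAT THIS FILE DOES.  The tree already holds, for an abstract system of torsion layers `E` of
`𝐃 = toGaloisModule S ρ` and a family of LOCAL classes `y_v ∈ L_v^⊥` (`v ∈ Σ`):
* `exists_nonZeroDivisor_dualEnd_local_eq_zero` (C5c-2): cotorsion of `coker(φ_𝓛)` + "the global
  functional of `(y_v)` kills `im φ_𝓛`" ⇒ `∃ r ∈ Λ⁰, (r̂ y)_v = 0 ∀ v ∈ Σ`;
* `globalFunctional_phi_eq_zero` (C5c-1): the global functional kills `im φ_𝓛` as soon as every class
  of `H¹(K_Σ/K, 𝐃)` and the family `(y_v)` have unramified level-`k` companions;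
* `exists_level_restrictedInf_eq` (C5c-3): level lifts of the classes of `H¹(K_Σ/K, 𝐃)`;
* `locDual_mem_dualLocalCondition_iff`, `localProj_locDual` (levels of `S_{𝓛*}`).
Here these are GLUED for the concrete layers `E = torsionLayers ρ e hD = (𝐃[𝔪ᵏ])_k` of a cofinitely
generated `𝐃` over `Λ ≅ ℤ_p⟦T₁,…,T_m⟧` and a GLOBAL class `y ∈ S_{𝓛*}(K, T*) = dualSelmer ρ e hD inv L`:
(1) the level companions of `y` off `Σ` are unramified (`hUO`: `H¹_ur^⊥ = H¹_ur` at the levels, read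
through `locDual_mem_dualLocalCondition_iff`); (2) hence the global functional of `(loc_v y)_v` kills
`im φ_𝓛` (`globalFunctional_phi_eq_zero_of_mem_dualSelmer`); (3) hence some `r ∈ Λ⁰` has
`loc_v (r̂ y) = 0` for all `v ∈ Σ`, and `r̂` preserves the off-`Σ` unramified dual condition
(`cohomologyMap_mem_dualLocalCondition_unramified`), i.e. **`r̂ y ∈ Ш¹(K, Σ, T*) = dualSha ρ e hD inv`
with `r ≠ 0`** (`exists_ne_zero_scalar_mem_dualSha_of_mem_dualSelmer`) — the `hC5` input of
`Specification.sur_of_dualSelmer_inputs`, modulo the Poitou–Tate level facts `hPT`/`hUO`, perfectness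
`hperf` and the level-change law `hinv` of the chosen invariant maps (all hypotheses here; for the
canonical invariant maps they are theorems of the tree, Summits-side).

HONESTY: nothing about SUR, Prop. 3.2.1's conclusion or BSD is proved here; cotorsion of `coker(φ_𝓛)`
and the Poitou–Tate inputs are hypotheses.  AI formalisation, weaker than expert review; the statements
are established only by the kernel check.

## References
* R. Greenberg, *Surjectivity of the global-to-local map defining a Selmer group*, Kyoto J. Math.
  50 (2010) 853–888, §2 p. 6, §3.1 and Prop. 3.1.1 (p. 14), proof of Prop. 3.2.1 (p. 15).
  [Greenberg2010]
* R. Greenberg, *On the structure of Selmer groups*, Springer PROMS 188 (2016), §2.3, §2.6, §4.1.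
  [Greenberg2016Selmer]
* J. S. Milne, *Arithmetic Duality Theorems*, 2nd ed. (2006), Ch. I §2 (unramified cohomology),
  Thm. 4.10. [MilneADT2006]
-/

noncomputable section

open scoped Classical
open Function CategoryTheory NumberField IsDedekindDomain Field IsLocalRing
open _root_.TopRep _root_.ContRepresentation _root_.ContinuousCohomology
open Literature.NumberTheory.GaloisRepresentations
open Literature.NumberTheory.GaloisRepresentations.DiscreteGaloisModule
open Literature.NumberTheory.GaloisRepresentations.DiscreteGaloisModule.TorsionLayers
open Literature.NumberTheory.IwasawaTheory.Greenberg2006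
open Literature.NumberTheory.GaloisCohomology (LocalInvariants)

namespace Literature.NumberTheory.IwasawaTheory.Greenberg2016

/-! ### §1. `r̂` preserves a dual local condition `U^⊥` whenever `r` preserves `U` (any layers `E`) -/

section Stable

variable {K : Type} [Field K] [NumberField K] {S : Set (HeightOneSpectrum (𝓞 K))}
  {Λ : Type} [CommRing Λ] [TopologicalSpace Λ]
  {D : Type} [AddCommGroup D] [Module Λ D] [TopologicalSpace D] [DiscreteTopology D]
  [ContinuousSMul Λ D]
  {ρ : ContinuousRep (GaloisGroupUnramifiedOutside K S) Λ D}
  {p : ℕ} [NeZero p] {E : (toGaloisModule S ρ).TorsionLayers p}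
  {inv : ∀ k : ℕ, LocalInvariants K (p ^ k)}

/-- **`U^⊥` is stable under `r̂` when `U ≤ H¹(K_v, 𝐃)` is stable under `(r •)_*`**: `⟪t, r̂ y⟫ = ⟪(r •)_* t, y⟫`
(the tree's `limitPairing_cohomologyMap_end`), so `y ∈ U^⊥ ⇒ r̂ y ∈ U^⊥`.
[cite: Greenberg2010, §2 p. 6 L5–8, §3.1 p. 14 L13–20] -/
theorem cohomologyMap_mem_dualLocalCondition_of_stable (hinv : ∀ v : Place K, InvLevelLaw inv v)
    (hΛ : ∀ (r : Λ) (k : ℕ), ∀ d ∈ E.N k, r • d ∈ E.N k) (r : Λ) (v : Place K)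
    (Θ' : (E.localDualSystem v).limitRep.toTopRep ⟶ (E.localDualSystem v).limitRep.toTopRep)
    (hΘ' : ∀ x, Θ'.hom x = E.dualEnd (DistribSMul.toAddMonoidHom D r) (hΛ r) x)
    (U : AddSubgroup (galoisCohomology ((toGaloisModule S ρ).toLocal v) 1))
    (hU : ∀ t ∈ U, galoisCohomology.map (toGaloisModuleLocalHom S ρ ρ (r • ContinuousLinearMap.id Λ D)
        (fun g a => ((ρ g).map_smul r a).symm) v) 1 t ∈ U)
    {yv : continuousCohomology 1 (E.localDualSystem v).limitRep.toTopRep}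
    (hyv : yv ∈ E.dualLocalCondition inv v U) :
    cohomologyMap Θ' 1 yv ∈ E.dualLocalCondition inv v U := by
  rw [TorsionLayers.mem_dualLocalCondition_iff] at hyv ⊢
  intro t ht
  -- `⟪t, r̂ y⟫ = ⟪(r •)_* t, y⟫`
  have hadj := E.limitPairing_cohomologyMap_end (DistribSMul.toAddMonoidHom D r) (hΛ r) inv
    (smul_toGaloisModule_apply r) v (hinv v)
    (TopRep.ofHom ⟨(toGaloisModuleLocalHom S ρ ρ (r • ContinuousLinearMap.id Λ D)
        (fun g a => ((ρ g).map_smul r a).symm) v).toContinuousLinearMap,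
      (toGaloisModuleLocalHom S ρ ρ (r • ContinuousLinearMap.id Λ D)
        (fun g a => ((ρ g).map_smul r a).symm) v).isIntertwining'⟩)
    (fun _ => rfl) Θ' hΘ' t yv
  rw [← limitPairing_apply (hinv v), ← hadj, limitPairing_apply]
  exact hyv _ (hU t ht)

/-- **`H¹_ur(K_w, 𝐃)^⊥` is stable under `r̂`** (`w` finite): `(r •)_*` preserves unramified classes
(the tree's `galoisCohomology.map_unramifiedSubgroup_le`), so `cohomologyMap_mem_dualLocalCondition_of_stable`
applies — the off-`Σ` clause of `S_{𝓛*}(K, T*)` and of `Ш¹(K, Σ, T*)` is a `Λ`-submodule condition.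
[cite: Greenberg2010, §3.1 p. 14 L13–26] [cite: MilneADT2006, Ch. I §2 (unramified cohomology)] -/
theorem cohomologyMap_mem_dualLocalCondition_unramified (hinv : ∀ v : Place K, InvLevelLaw inv v)
    (hΛ : ∀ (r : Λ) (k : ℕ), ∀ d ∈ E.N k, r • d ∈ E.N k) (r : Λ) (w : HeightOneSpectrum (𝓞 K))
    (Θ' : (E.localDualSystem (Sum.inr w)).limitRep.toTopRep ⟶
      (E.localDualSystem (Sum.inr w)).limitRep.toTopRep)
    (hΘ' : ∀ x, Θ'.hom x = E.dualEnd (DistribSMul.toAddMonoidHom D r) (hΛ r) x)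
    {yv : continuousCohomology 1 (E.localDualSystem (Sum.inr w)).limitRep.toTopRep}
    (hyv : yv ∈ E.dualLocalCondition inv (Sum.inr w)
      (unramifiedSubgroup (GaloisRep.toLocal w (toGaloisModule S ρ)) 1)) :
    cohomologyMap Θ' 1 yv ∈ E.dualLocalCondition inv (Sum.inr w)
      (unramifiedSubgroup (GaloisRep.toLocal w (toGaloisModule S ρ)) 1) :=
  cohomologyMap_mem_dualLocalCondition_of_stable hinv hΛ r (Sum.inr w) Θ' hΘ'
    (unramifiedSubgroup (GaloisRep.toLocal w (toGaloisModule S ρ)) 1)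
    (fun t ht => galoisCohomology.map_unramifiedSubgroup_le
      (τ := GaloisRep.toLocal w (toGaloisModule S ρ)) (τ' := GaloisRep.toLocal w (toGaloisModule S ρ))
      (toGaloisModuleLocalHom S ρ ρ (r • ContinuousLinearMap.id Λ D)
        (fun g a => ((ρ g).map_smul r a).symm) (Sum.inr w)) ⟨t, ht, rfl⟩) hyv

end Stable

/-! ### §2. The layers `𝐃[𝔪ᵏ]`: level lifts, unramified level companions, and the glued (β) -/

section Glue

variable {K : Type} [Field K] [NumberField K] {S : Set (HeightOneSpectrum (𝓞 K))}
  {Λ : Type} [CommRing Λ] [TopologicalSpace Λ]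
  {D : Type} [AddCommGroup D] [Module Λ D] [TopologicalSpace D] [DiscreteTopology D]
  [ContinuousSMul Λ D]
  (ρ : ContinuousRep (GaloisGroupUnramifiedOutside K S) Λ D)
  {p : ℕ} [Fact p.Prime] {m : ℕ} [IsLocalRing Λ]
  (e : Λ ≃+* MvPowerSeries (Fin m) ℤ_[p]) (hD : IsCofinitelyGenerated Λ D)
  {inv : ∀ k : ℕ, LocalInvariants K (p ^ k)} {L : Specification S ρ}

omit [NumberField K] [DiscreteTopology D] [ContinuousSMul Λ D] in
/-- **`𝐃[𝔪ᵏ]` is `G_{K,Σ}`-stable** (`ρ` is `Λ`-linear). [cite: Greenberg2010, §2 p. 6 L5–8] -/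
theorem torsionBySet_maximalIdeal_pow_le_comap (k : ℕ) (g : GaloisGroupUnramifiedOutside K S) :
    Submodule.torsionBySet Λ D ((maximalIdeal Λ ^ k : Ideal Λ) : Set Λ) ≤
      (Submodule.torsionBySet Λ D ((maximalIdeal Λ ^ k : Ideal Λ) : Set Λ)).comap (ρ g) := by
  intro d hd
  rw [Submodule.mem_comap, Submodule.mem_torsionBySet_iff]
  rw [Submodule.mem_torsionBySet_iff] at hd
  intro a
  rw [← map_smul, hd a, map_zero]

omit [NumberField K] [ContinuousSMul Λ D] in
/-- **The level-`k` module of `torsionLayers ρ e hD` is the inflated module of `ρ|_{𝐃[𝔪ᵏ]}`,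
definitionally** (cf. the tree's `layerRep_lambdaTorsionLayers`). [cite: Greenberg2010, §2 p. 6 L1–12] -/
theorem layerRep_torsionLayers (k : ℕ) :
    (torsionLayers ρ e hD).layerRep k =
      toGaloisModule S (ρ.subrepresentation
        (Submodule.torsionBySet Λ D ((maximalIdeal Λ ^ k : Ideal Λ) : Set Λ))
        (torsionBySet_maximalIdeal_pow_le_comap ρ k)) :=
  rfl

omit [NumberField K] [ContinuousSMul Λ D] in
/-- Off `S` every level `𝐃[𝔪ᵏ]` is unramified (it is inflated from `G_{K,S}`; the tree's
`isUnramifiedOutside_toGaloisModule`). [cite: Greenberg2010, §3.1 p. 14 L21–26] -/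
theorem isUnramifiedAt_layerRep_torsionLayers (k : ℕ) {w : HeightOneSpectrum (𝓞 K)} (hw : w ∉ S) :
    GaloisRep.IsUnramifiedAt w ((torsionLayers ρ e hD).layerRep k) :=
  isUnramifiedOutside_toGaloisModule S (ρ.subrepresentation
    (Submodule.torsionBySet Λ D ((maximalIdeal Λ ^ k : Ideal Λ) : Set Λ))
    (torsionBySet_maximalIdeal_pow_le_comap ρ k)) w hw

omit [NumberField K] [ContinuousSMul Λ D] in
/-- **`H¹` of the inclusion `𝐃[𝔪ᵏ] ⊆ 𝐃` in the two currencies of the tree agree definitionally**: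
`galoisCohomology.map (layerSubtypeHom k)` (the `TorsionLayers` API) is `cohomologyMap` of the
coefficient morphism `toGaloisModuleHom` of the `Λ`-linear inclusion (the level-lift API).
[cite: Greenberg2010, §3.1 p. 14 L13–20] -/
theorem galoisCohomology_map_layerSubtypeHom_torsionLayers (k : ℕ)
    (xk : galoisCohomology ((torsionLayers ρ e hD).layerRep k) 1) :
    galoisCohomology.map ((torsionLayers ρ e hD).layerSubtypeHom k).hom 1 xk =
      (cohomologyMap (toGaloisModuleHom S (ρ.subrepresentation
        (Submodule.torsionBySet Λ D ((maximalIdeal Λ ^ k : Ideal Λ) : Set Λ))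
        (torsionBySet_maximalIdeal_pow_le_comap ρ k)) ρ
        (Submodule.torsionBySet Λ D ((maximalIdeal Λ ^ k : Ideal Λ) : Set Λ)).subtypeL
        (fun _ _ => rfl)) 1).hom xk :=
  rfl

/-- **Every class of `H¹(K_Σ/K, 𝐃)` has an unramified level companion in the layers `𝐃[𝔪ᵏ]`**:
`inf x = (𝐃[𝔪ᵏ] ⊆ 𝐃)_* x_k` with `x_k` inflated from `G_{K,Σ}` (hence unramified off `S`) — the tree's
`exists_level_restrictedInf_eq` / `localization_restrictedInf_mem_unramifiedSubgroup` for the directed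
exhaustive family `(𝐃[𝔪ᵏ])_k` ("`𝐃 = ⋃ 𝐃[𝔪ⁿ]`"). [cite: Greenberg2010, §3.1 p. 14 L13–26]
[cite: Greenberg2016Selmer, §4.1 p. 15 L27–29] -/
theorem exists_level_lift_torsionLayers (x : ρ.H 1) :
    ∃ (k : ℕ) (xk : galoisCohomology ((torsionLayers ρ e hD).layerRep k) 1),
      galoisCohomology.map ((torsionLayers ρ e hD).layerSubtypeHom k).hom 1 xk =
        (toGaloisModule S ρ).restrictedInf S 1 ((restrictedHAddEquiv S ρ 1).symm x) ∧
      ∀ w : HeightOneSpectrum (𝓞 K), w ∉ S →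
        galoisCohomology.localization ((torsionLayers ρ e hD).layerRep k) (Sum.inr w) 1 xk ∈
          unramifiedSubgroup (GaloisRep.toLocal w ((torsionLayers ρ e hD).layerRep k)) 1 := by
  have hmono : Monotone fun k : ℕ =>
      Submodule.torsionBySet Λ D ((maximalIdeal Λ ^ k : Ideal Λ) : Set Λ) :=
    fun k l hkl d hd => (torsionLayers ρ e hD).mono hkl hd
  have hex : ∀ d : D, ∃ k, d ∈ (fun k : ℕ =>
      Submodule.torsionBySet Λ D ((maximalIdeal Λ ^ k : Ideal Λ) : Set Λ)) k :=
    fun d => (torsionLayers ρ e hD).exhaustive d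
  obtain ⟨k, c, hc⟩ := exists_level_restrictedInf_eq S ρ
    (fun k : ℕ => Submodule.torsionBySet Λ D ((maximalIdeal Λ ^ k : Ideal Λ) : Set Λ))
    (torsionBySet_maximalIdeal_pow_le_comap ρ) hmono.directed_le hex x
  refine ⟨k, (toGaloisModule S (ρ.subrepresentation _
    (torsionBySet_maximalIdeal_pow_le_comap ρ k))).restrictedInf S 1 c, ?_, fun w hw => ?_⟩
  · exact hc
  · exact localization_restrictedInf_mem_unramifiedSubgroup S ρ _
      (torsionBySet_maximalIdeal_pow_le_comap ρ) k c hw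

/-- **The level companions of a class of `S_{𝓛*}(K, T*)` are unramified off `S`**: if
`loc_w y ∈ H¹_ur(K_w, 𝐃)^⊥` (`w ∉ S`, so `w ∤ p`), then for every `k` the `w`-localisation of the level-`k`
component `y_k ∈ H¹(K, Hom(𝐃[𝔪ᵏ], μ_{p^k}))` lies in `H¹_ur(K_w, Hom(𝐃[𝔪ᵏ], μ_{p^k}))`: levelwise
(`locDual_mem_dualLocalCondition_iff`) `loc_w y_k ⊥ (𝐃[𝔪ᵏ] ⊆ 𝐃)_*⁻¹ H¹_ur(K_w, 𝐃) ⊇ H¹_ur(K_w, 𝐃[𝔪ᵏ])`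
(functoriality of unramified classes), and `H¹_ur(K_w, 𝐃[𝔪ᵏ])^⊥ = H¹_ur(K_w, Hom(𝐃[𝔪ᵏ], μ_{p^k}))`
(`hUO`, Milne I Thm. 2.6, `𝐃[𝔪ᵏ]` unramified at `w ∤ p^k`).
[cite: Greenberg2010, §3.1 p. 14 L21–26] [cite: MilneADT2006, Ch. I Thm. 2.6] -/
theorem localization_level_mem_unramifiedSubgroup_of_mem_dualSelmer
    (hSp : ∀ w : HeightOneSpectrum (𝓞 K), ((p : ℕ) : 𝓞 K) ∈ w.asIdeal → w ∈ S)
    (hinv : ∀ v : Place K, InvLevelLaw inv v) (hUO : ∀ k, (inv k).UnramifiedOrthogonal)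
    {y : continuousCohomology 1 (torsionLayers ρ e hD).dualSystem.limitRep.toTopRep}
    (hy : y ∈ dualSelmer ρ e hD inv L) (k : ℕ) {w : HeightOneSpectrum (𝓞 K)} (hw : w ∉ S) :
    haveI := (torsionLayers ρ e hD).finite k
    galoisCohomology.localization ((torsionLayers ρ e hD).layerDualRep k) (Sum.inr w) 1
        (cohomologyMap ((torsionLayers ρ e hD).dualSystem.projHom k) 1 y) ∈
      unramifiedSubgroup
        (GaloisRep.toLocal w (((torsionLayers ρ e hD).layerRep k).tateDual (p ^ k))) 1 := by
  haveI : NeZero p := ⟨(Fact.out : p.Prime).ne_zero⟩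
  haveI : ∀ k, Finite ((torsionLayers ρ e hD).N k) := fun k => (torsionLayers ρ e hD).finite k
  -- the off-`S` clause of `S_{𝓛*}` read at the level `k`
  have h1 := (locDual_mem_dualLocalCondition_iff (E := torsionLayers ρ e hD) (hinv (Sum.inr w))
    (unramifiedSubgroup (GaloisRep.toLocal w (toGaloisModule S ρ)) 1) y).1 (hy.2 w hw) k
  -- `H¹_ur(K_w, 𝐃[𝔪ᵏ]) ≤ (𝐃[𝔪ᵏ] ⊆ 𝐃)_*⁻¹ H¹_ur(K_w, 𝐃)`
  have h2 : unramifiedSubgroup (GaloisRep.toLocal w ((torsionLayers ρ e hD).layerRep k)) 1 ≤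
      (unramifiedSubgroup (GaloisRep.toLocal w (toGaloisModule S ρ)) 1).comap
        ((torsionLayers ρ e hD).localSubtypeMap (Sum.inr w) k) := fun a ha =>
    galoisCohomology.map_unramifiedSubgroup_le
      (τ := GaloisRep.toLocal w ((torsionLayers ρ e hD).layerRep k))
      (τ' := GaloisRep.toLocal w (toGaloisModule S ρ))
      (((torsionLayers ρ e hD).layerSubtypeHom k).hom.restrictField
        (Place.Completion (Sum.inr w : Place K))) ⟨a, ha, rfl⟩
  have h3 := (inv k).dualLocalCondition_anti ((torsionLayers ρ e hD).layerRep k) (Sum.inr w) h2 h1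
  -- `w ∤ p^k`, `𝐃[𝔪ᵏ]` unramified at `w`: `H¹_ur^⊥ = H¹_ur` at the level `k`
  have hpk : ((p ^ k : ℕ) : 𝓞 K) ∉ w.asIdeal := fun h =>
    hw (hSp w (w.isPrime.mem_of_pow_mem k (by rwa [Nat.cast_pow] at h)))
  rw [((hUO k) ((torsionLayers ρ e hD).layerRep k)
    (fun c => (torsionLayers ρ e hD).pow_smul_eq_zero c) w hpk
    (isUnramifiedAt_layerRep_torsionLayers ρ e hD k hw)).1] at h3
  exact h3

/-- **`G ⊥ G*` for `S_{𝓛*}(K, T*)` and the layers `𝐃[𝔪ᵏ]`**: for `y ∈ S_{𝓛*}(K, T*)` the global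
functional `t̄ ↦ ∑_{v ∈ Σ} ⟪t_v, loc_v y⟫_v` kills `im φ_𝓛` — every class `x ∈ H¹(K_Σ/K, 𝐃)` has an
unramified level companion (`exists_level_lift_torsionLayers`), `y` has the level companions `y_k`
(`localProj_locDual`), unramified off `S` (`localization_level_mem_unramifiedSubgroup_of_mem_dualSelmer`),
and Poitou–Tate at the level `k` concludes (the tree's `globalFunctional_phi_eq_zero`).
[cite: Greenberg2010, §3.1 p. 14 L13–26] [cite: MilneADT2006, Ch. I, Thm. 4.10] -/
theorem globalFunctional_phi_eq_zero_of_mem_dualSelmer [Finite (SigmaPlace S)]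
    (Sig : Finset (Place K)) (hSig : ∀ v : Place K, v ∈ Sig ↔ InSigma S v)
    (hSp : ∀ w : HeightOneSpectrum (𝓞 K), ((p : ℕ) : 𝓞 K) ∈ w.asIdeal → w ∈ S)
    (hinv : ∀ v : Place K, InvLevelLaw inv v)
    (hPT : ∀ k, (inv k).SumLocalTermEqZero) (hUO : ∀ k, (inv k).UnramifiedOrthogonal)
    {y : continuousCohomology 1 (torsionLayers ρ e hD).dualSystem.limitRep.toTopRep}
    (hy : y ∈ dualSelmer ρ e hD inv L) (x : ρ.H 1) :
    haveI : NeZero p := ⟨(Fact.out : p.Prime).ne_zero⟩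
    globalFunctional (S := S) (ρ := ρ) (L := L) (E := torsionLayers ρ e hD) hinv
      (fun v : SigmaPlace S =>
        (torsionLayers ρ e hD).locDual (absGaloisRestrict K (Place.Completion v.1)) y)
      (fun v => hy.1 v.1 v.2) (L.phi x) = 0 := by
  haveI : ∀ k, Finite ((torsionLayers ρ e hD).N k) := fun k => (torsionLayers ρ e hD).finite k
  obtain ⟨k, xk, hx, hxk⟩ := exists_level_lift_torsionLayers ρ e hD x
  exact globalFunctional_phi_eq_zero hinv Sig hSig hSp (hPT k) (hUO k)
    (fun w hw => isUnramifiedAt_layerRep_torsionLayers ρ e hD k hw) _ _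
    (cohomologyMap ((torsionLayers ρ e hD).dualSystem.projHom k) 1 y)
    (fun v => (torsionLayers ρ e hD).localProj_locDual v.1 k y)
    (fun w hw =>
      localization_level_mem_unramifiedSubgroup_of_mem_dualSelmer ρ e hD hSp hinv hUO hy k hw)
    x xk hx hxk

/-- **Greenberg 2010, proof of Prop. 3.2.1, step (β), for `S_{𝓛*}(K, T*)` of a cofinitely generated
`𝐃` over `Λ ≅ ℤ_p⟦T₁,…,T_m⟧`**: if `coker(φ_𝓛)` is cotorsion, `K` is totally complex, and the chosen
invariant maps are perfect with the Poitou–Tate level facts and the level-change law, then every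
`y ∈ S_{𝓛*}(K, T*)` has `r̂ y ∈ Ш¹(K, Σ, T*)` for some `r ≠ 0` in `Λ` — "by proposition 3.1.1, and the
assumption about the cokernel of `φ_𝓛`, `S_{𝓛*}(K, T*)` is a torsion `Λ`-module" modulo `Ш¹`.  (Glue of
the tree's `exists_nonZeroDivisor_dualEnd_local_eq_zero` at the local classes `loc_v y`, whose global
functional kills `im φ_𝓛` by `globalFunctional_phi_eq_zero_of_mem_dualSelmer`; `loc_v (r̂ y) = r̂ (loc_v y)`
and `r̂` preserves the off-`Σ` clause.)  This is the input `hC5` of `Specification.sur_of_dualSelmer_inputs`.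
[cite: Greenberg2010, Prop. 3.1.1 (p. 14) and proof of Prop. 3.2.1 (p. 15 L19–29)] -/
theorem exists_ne_zero_scalar_mem_dualSha_of_mem_dualSelmer [IsTotallyComplex K]
    [Finite (SigmaPlace S)] (Sig : Finset (Place K)) (hSig : ∀ v : Place K, v ∈ Sig ↔ InSigma S v)
    (hSp : ∀ w : HeightOneSpectrum (𝓞 K), ((p : ℕ) : 𝓞 K) ∈ w.asIdeal → w ∈ S)
    (hinv : ∀ v : Place K, InvLevelLaw inv v) (hperf : ∀ k, (inv k).IsPerfect)
    (hPT : ∀ k, (inv k).SumLocalTermEqZero) (hUO : ∀ k, (inv k).UnramifiedOrthogonal)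
    (hcot : IsCotorsion Λ (L.QGlobal ⧸ LinearMap.range L.phi))
    {y : continuousCohomology 1 (torsionLayers ρ e hD).dualSystem.limitRep.toTopRep}
    (hy : y ∈ dualSelmer ρ e hD inv L) :
    ∃ r : Λ, r ≠ 0 ∧ cohomologyMap (scalarDualEndHom ρ e hD r) 1 y ∈ dualSha ρ e hD inv := by
  haveI : NeZero p := ⟨(Fact.out : p.Prime).ne_zero⟩
  haveI : Nontrivial Λ := e.symm.injective.nontrivial
  have hΛ : ∀ (r : Λ) (k : ℕ), ∀ d ∈ (torsionLayers ρ e hD).N k, r • d ∈ (torsionLayers ρ e hD).N k :=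
    fun r k d hd => smul_mem_torsionLayers ρ e hD k r d hd
  -- (β) at the local classes `loc_v y`, `v ∈ Σ`
  have hker := globalFunctional_phi_eq_zero_of_mem_dualSelmer ρ e hD Sig hSig hSp hinv hPT hUO hy
  have hmain := exists_nonZeroDivisor_dualEnd_local_eq_zero (L := L) (E := torsionLayers ρ e hD)
    hinv hΛ hcot hperf
    (fun r (v : SigmaPlace S) => (torsionLayers ρ e hD).dualEndHomComap
      (absGaloisRestrict K (Place.Completion v.1)) (DistribSMul.toAddMonoidHom D r) (hΛ r)
      (smul_toDiscreteGaloisModule_comm ρ r))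
    (fun _ _ _ => rfl)
    (fun v : SigmaPlace S =>
      (torsionLayers ρ e hD).locDual (absGaloisRestrict K (Place.Completion v.1)) y)
    (fun v => hy.1 v.1 v.2) hker
  obtain ⟨r, hr0, hr⟩ := hmain
  refine ⟨r, nonZeroDivisors.ne_zero hr0, fun v hv => ?_, fun w hw => ?_⟩
  · -- `loc_v (r̂ y) = r̂ (loc_v y) = 0` for `v ∈ Σ`
    have h : (torsionLayers ρ e hD).locDual (absGaloisRestrict K (Place.Completion v))
        (cohomologyMap (scalarDualEndHom ρ e hD r) 1 y) = _ :=
      (torsionLayers ρ e hD).locDual_cohomologyMap_dualEndHom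
        (absGaloisRestrict K (Place.Completion v)) (DistribSMul.toAddMonoidHom D r) (hΛ r)
        (smul_toDiscreteGaloisModule_comm ρ r) y
    exact h.trans (hr ⟨v, hv⟩)
  · -- off `Σ`: `loc_w (r̂ y) = r̂ (loc_w y) ∈ H¹_ur^⊥`
    have h : (torsionLayers ρ e hD).locDual (absGaloisRestrict K (Place.Completion (Sum.inr w : Place K)))
        (cohomologyMap (scalarDualEndHom ρ e hD r) 1 y) = _ :=
      (torsionLayers ρ e hD).locDual_cohomologyMap_dualEndHom
        (absGaloisRestrict K (Place.Completion (Sum.inr w : Place K))) (DistribSMul.toAddMonoidHom D r)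
        (hΛ r) (smul_toDiscreteGaloisModule_comm ρ r) y
    rw [h]
    exact cohomologyMap_mem_dualLocalCondition_unramified (ρ := ρ) (E := torsionLayers ρ e hD) hinv hΛ r w
      _ (fun _ => rfl) (hy.2 w hw)

end Glue

end Literature.NumberTheory.IwasawaTheory.Greenberg2016

end
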